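import Mathlib
import Literature.Computability.AlgebraicComplexity.BirkhoffShadow
import Summits.ValiantsHypothesis.ValiantsHypothesis.Theses.DivisionGap

/-!
# Sketch — first lemmas for the crux-ideate cards on `ShadowBirkhoff` (stmt-ValiantsHypothesis-5069)

Ideator 2, round 1.  Nothing here is proved; every `theorem` is a SIGNATURE the line would start
from (sorried), every `def … : Prop` a transfer target.  All constants are existing declarations:
`Literature.Computability.AlgebraicComplexity.permMatrixPoints / birkhoffShadowVertexCount`
(BirkhoffShadow.lean) and the route decl
`Summit.ValiantsHypothesis.ValiantsHypothesis.Theses.DivisionGap.ShadowBirkhoff`.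
-/

noncomputable section

open Literature.Computability.AlgebraicComplexity
open Summit.ValiantsHypothesis.ValiantsHypothesis.Theses.DivisionGap (ShadowBirkhoff)

namespace Summit.ValiantsHypothesis.ValiantsHypothesis.Cruxes.ShadowBirkhoff.Sketch

/-! ## Shared: faces of the Birkhoff polytope transfer (up to a factor 2) -/

/-- The permutation matrices lying inside a 0/1 pattern `Z` (a face of `DS_n`: perfect matchings
of the bipartite graph `Z`). Same encoding as the crux: entry `(i, j) = 1` iff `ρ j = i`. -/
def patternPoints (n : ℕ) (Z : Set (Fin n × Fin n)) : Set (Fin n × Fin n → ℝ) :=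
  {x | ∃ ρ : Equiv.Perm (Fin n), (∀ j, (ρ j, j) ∈ Z) ∧ x = fun ij => if ρ ij.2 = ij.1 then 1 else 0}

/-- Shadow vertex count of the face cut out by the pattern `Z`. -/
def patternShadowVertexCount {n : ℕ} (Z : Set (Fin n × Fin n))
    (L : (Fin n × Fin n → ℝ) →ₗ[ℝ] (Fin 2 → ℝ)) : ℕ :=
  (Set.extremePoints ℝ (convexHull ℝ (L '' patternPoints n Z))).ncard

/-- FIRST LEMMA (both cards) — face transfer.  A shadow of a face is seen, on a half-circle of
directions, by a shadow of the whole polytope: tilt `L` by `M • (faceFunctional, 0)`-type term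
with `M` large; the (closed) upper chain of the face polygon w.r.t. a generic direction survives,
and it has at least half of the vertices.  Hence `σ(face) ≤ 2 σ(DS_n)`. -/
theorem faceShadow_le_two_mul {n : ℕ} (Z : Set (Fin n × Fin n))
    (L : (Fin n × Fin n → ℝ) →ₗ[ℝ] (Fin 2 → ℝ)) :
    ∃ L' : (Fin n × Fin n → ℝ) →ₗ[ℝ] (Fin 2 → ℝ),
      patternShadowVertexCount Z L ≤ 2 * birkhoffShadowVertexCount L' := by
  sorry

/-! ## Card `polytrope-kr-planar-dimers`: the domino face and its transfer -/

/-- Grid adjacency on `Fin m × Fin m`. -/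
def IsGridAdjacent {m : ℕ} (v w : Fin m × Fin m) : Prop :=
  (((v.1 : ℕ) + 1 = w.1 ∧ v.2 = w.2) ∨ ((w.1 : ℕ) + 1 = v.1 ∧ v.2 = w.2) ∨
    (v.1 = w.1 ∧ (v.2 : ℕ) + 1 = w.2) ∨ (v.1 = w.1 ∧ (w.2 : ℕ) + 1 = v.2))

/-- Domino tilings of the `m × m` square as points of `ℝ^{V × V}`, `V = Fin m × Fin m`: the
indicator of the graph of a fixed-point-free grid-adjacent involution (the encoding of the route's
`SquareGridDimersDivisionEasy`).  Their convex hull is a linear image of the perfect-matching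
polytope of the grid = a face of `DS_{m²/2}`; by Thurston/Propp it is affinely a Lipschitz
polytrope `{g : g q − g p ≤ d_pq ∈ {0,1}}` on the faces of the grid. -/
def dominoPoints (m : ℕ) : Set ((Fin m × Fin m) × (Fin m × Fin m) → ℝ) :=
  {x | ∃ f : Fin m × Fin m → Fin m × Fin m,
    (∀ v, f (f v) = v ∧ f v ≠ v ∧ IsGridAdjacent v (f v)) ∧ x = fun e => if f e.1 = e.2 then 1 else 0}

/-- TRANSFER TARGET `C⁺` of card A: the domino face alone has super-quasi-polynomial shadow
complexity (equivalently: parametric max-weight domino tiling / the Kantorovich–Rubinstein norm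
`λ ↦ ‖W₁ + λ W₂‖` on the grid quasi-metric has super-quasi-polynomially many breakpoints). -/
def DominoShadow : Prop :=
  ∀ c : ℕ, ∃ m₀ : ℕ, ∀ m ≥ m₀,
    ∃ L : (((Fin m × Fin m) × (Fin m × Fin m)) → ℝ) →ₗ[ℝ] (Fin 2 → ℝ),
      2 ^ ((Nat.log 2 m + c) ^ c) < (Set.extremePoints ℝ (convexHull ℝ (L '' dominoPoints m))).ncard

/-- The transfer (routine given `faceShadow_le_two_mul`: tilings ↦ permutation matrices of the
black/white bipartite adjacency is injective-affine; pad `DS_{m²/2}` into `DS_N` by fixed points;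
`log₂ N ≤ 2 log₂ m + 3` absorbs into the constant `c`). -/
theorem shadowBirkhoff_of_dominoShadow : DominoShadow → ShadowBirkhoff := by
  sorry

/-- The planar ceiling (separator argument, Lipton–Tarjan + Gusfield midpoint recursion): any
planar dimer face has at most `2^{O(√n log n)}` shadow vertices — stated for dominoes.  (So card A
can settle the crux but not HY21's `2^{Ω(n)}`.) -/
theorem dominoShadow_le (m : ℕ) (L : (((Fin m × Fin m) × (Fin m × Fin m)) → ℝ) →ₗ[ℝ] (Fin 2 → ℝ)) :
    (Set.extremePoints ℝ (convexHull ℝ (L '' dominoPoints m))).ncard ≤ 2 ^ (64 * (m + 1) * (Nat.log 2 (m + 1) + 1)) := by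
  sorry

/-! ## Card `rotor-bootstrap-link-gadgets`: the treewidth no-go that forces interaction cycles -/

/-- NO-GO used by card B (Gusfield midpoint recursion for a width-2 trellis): configurations of
`w + 1` bits whose two functionals are sums of NEAREST-NEIGHBOUR terms have only `O(w²)` shadow
vertices — so any gadget construction must make the bit-interaction graph have large treewidth
(cycles), which is where the port/wall analysis of the card starts. -/
theorem chainShadow_le (w : ℕ) (a b : Fin (w + 1) → Fin 2 → Fin 2 → ℝ) :
    (Set.extremePoints ℝ (convexHull ℝ
      {p : Fin 2 → ℝ | ∃ x : Fin (w + 2) → Fin 2,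
        p = ![∑ i : Fin (w + 1), a i (x i.castSucc) (x i.succ),
              ∑ i : Fin (w + 1), b i (x i.castSucc) (x i.succ)]})).ncard ≤ 64 * (w + 2) ^ 2 := by
  sorry

end Summit.ValiantsHypothesis.ValiantsHypothesis.Cruxes.ShadowBirkhoff.Sketch

end
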